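import Summits.QuantumFields.BalabanUV.Beta.D1BFx.TorusWeightWordArrays
import Summits.QuantumFields.BalabanUV.Beta.D1BFx.TorusWeightJetsTwisted

/-!
# `BalabanUV.Beta.D1BFx.TorusWeightWordTwisted` — road «BF-x» for binder row D1, slot (K), chain step (I) «(A1)-PACKED», brick «COFRAME-ARRAYS»
# (TB4-W PART 3 at response-packed jets), FILE A «TWISTED-WORD-1»: **THE TWISTED FIRST WEIGHT JET `2•twgt₁` OF `TorusWeightJetsTwisted` IS THE
# PERIODISED ARRAY OF ONE FIXED `ℤ⁴` BOND KERNEL `tBw₁`** — the same five term letters as TB4-W 3b-N FILE N2 `TorusWeightWordArrays.two_smul_wgt₁_eq_hat`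
# (`Bw₁`) with the `M̂ₛᵀĈM̂₀`-term RE-SIGNED (`tgram₁ = −TₛᵀA₀T₀ + T₀ᵀAₛT₀ + T₀ᵀA₀Tₛ` carries `−` on its transposed odd jet): at the torus bond
# `(σu, κ)` and any basis `N` of `ker Ŝ`, `2 • twgt₁ s (σu,κ) N = (toF (arr s (tBw₁ (m+1) a κ u)))^`; so, by `TorusWeightJetsTwisted.tgram₁_Tjet`,
# **`tgram₁ (Tjet₀ …) (Tjet₁ (σu,κ) …) (Ajet₀ …) (Ajet₁ (σu,κ) …) = ((toF (arr s (tBw₁ (m+1) a κ u)))^).submatrix e e`** — the per-bond twisted co-frame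
# weight jet of PART 3b's `hJN` letter as an array; with its LOCALISATION (`BiLoc … u u C (dB∕8)`, one constant for every bond) and its PERIOD COVARIANCE
# (`tBw₁ κ (u + s·t) = shiftK (−s·t) (tBw₁ κ u)`, block covariance of `Cgh`∕`Rgt`) = the two hypotheses of `PeriodicArrayPackingPlain`'s packing

HONEST DEPENDENCY (cell records, verbatim): «continuum YM on T⁴ ⇐ BetaPertH ∧ nine spine estimates (0/9 proved); BetaPertH ⇐ (D1) ∧ (D4) ∧
CAP+tail; G-an2-4 gates asym, D1 and NE2/3/4.»  HONEST FRAMING (cell contract, verbatim): «discharging `BetaPertH` makes Bałaban's UV stability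
UNCONDITIONAL — a real constructive-QFT result; it is NOT the continuum limit and NOT the Clay problem.»  THIS MODULE DISCHARGES NOTHING of (K),
of D1 or of the wall: [our object] one kernel DEFINITION (asserting nothing) and [folklore] matrix algebra ∕ array calculus over FILE N2
(`Ljet_Cgh_Lhat`, `Lhat_Cgh_Ljet`, `Lhat_Cgh_Lsq_Cgh_Lhat`, `Djet_Rhat_Dhat_transpose`, `Dhat_Rhat_Djet_transpose`, `biLoc_dSw_wL∕wR∕wC`, `biLoc_jetR_jetC`,
`shiftK_Rgt_mul`), FILE N1 (`Dhat_mul_perT_arr_mul_Dhat_transpose`, `hat_arr_*`, `shiftK_lapU_Cgh`, `shiftK_Cgh_lapU`), 3a′ `TorusWeightJetsTwisted`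
(`twgt₁`, `tgram₁_Tjet`), `RJetAssembly.dSw_shiftK`, `GhostStencil.ghCur_translate`, `KGhostLegJunction.Chat_eq_submatrix_periodiseF_Cgh`, BY NAME.
No `def … : Prop`, nothing cited, 0 sorry.  0∕4 binders of row D1; (K) NOT closed; NOT D1, NOT BetaPertH, NOT continuum, NOT Clay.

ABSOLUTE RULE (cell charter, verbatim): «No internally-minted statement may enter as a cited fact. Every hypothesis is either kernel-proved in this
package or a verbatim quotation of a PUBLISHED theorem with page reference. The manuscript(s) under audit are NOT citable for their own disputed
steps — they are the thing under adjudication; programme-internal (2001/route/tribunal) claims are never citable.»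

CONTENT:
* §1 [our object] `tBw₁ n a κ u := 2•(dSw wL + jetR κ u Rgt − dSw wC + dSw wR − jetC κ u Rgt)`.
* §2 covariance: `jetR_translate`, `jetC_translate`, `wL_translate`∕`wR_translate`∕`wC_translate` (shifts by `((m+1)·p)·t`), **`tBw₁_translate`**, **`tBw₁_imageShift`**.
* §3 **`biLoc_tBw₁`**: `∃ C, 0 ≤ C ∧ ∀ κ u, BiLoc (tBw₁ (m+1) a κ u) u u C (dB (m+1) a ∕ 8)`.
* §4 **`two_smul_twgt₁_eq_hat`** (any basis `N` of `ker Ŝ`); **`tgram₁_Tjet_eq_hat_submatrix`** (the twisted co-frame weight jet of one bond as an array,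
  any re-indexing `e`); the road's `N̂` instances `two_smul_twgt₁_Nhat_eq_hat`, `tgram₁_Tjet_Nhat_eq_hat_submatrix` (`Nhat_range`∕`Nhat_injective`).
Unit `b2b-balaban-beta-d1-formalise-leaf-03` (gen 23); road owner `b2b-balaban-beta-d1-p2` (`OWNER-MEMO-g17.md` §2 item (2), Q-DICT-N l.40409).
-/

noncomputable section

namespace Summit.QuantumFields.BalabanUV.Beta.D1BFx.TorusWeightWordTwisted

open Matrix
open scoped BigOperators
open Literature.MathematicalPhysics.QuantumFieldTheory.Balaban1983to89
open Literature.MathematicalPhysics.QuantumFieldTheory.Balaban1983to89.Beta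
open B12Sec2to5 (l1 l1_nonneg)
open ExpKernelCalculus (MKer BiLoc Decays Zl comp shiftK comp_shiftK biLoc_comp_decays)
open AffineAveraging (box toSite unitVec)
open KernelWard (biLoc_add biLoc_sub)
open BalabanStepJetsSucc (biLoc_comp_right decays_comp)
open Summit.QuantumFields.BalabanUV.Beta.TameKernelCalculus (decays_of_le biLoc_of_le)
open Summit.QuantumFields.BalabanUV.Beta.D1BFx.PeriodicArrays (arr toF imageShift_eq_add_smul)
open Summit.QuantumFields.BalabanUV.Beta.D1BFx.FibredPeriodisation (periodiseF)
open Summit.QuantumFields.BalabanUV.Beta.D1BFx.GhostStencil (ghCur biLoc_ghCur ghCur_translate)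
open Summit.QuantumFields.BalabanUV.Beta.D1BFx.RJetProjector (Rgt)
open Summit.QuantumFields.BalabanUV.Beta.D1BFx.RJetAssembly (dSw dSw_shiftK)
open Summit.QuantumFields.BalabanUV.Beta.D1BFx.PeriodisedProjector (Lhat Shat)
open Summit.QuantumFields.BalabanUV.Beta.D1BFx.TorusHodgeWeight (Dhat)
open Summit.QuantumFields.BalabanUV.Beta.D1BFx.TorusGaugeWeight (Lhat_transpose)
open Summit.QuantumFields.BalabanUV.Beta.D1BFx.TorusGaugeBasisMatrix (Nhat)
open Summit.QuantumFields.BalabanUV.Beta.D1BFx.TorusGaugeBasisKernel (Nhat_range Nhat_injective)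
open Summit.QuantumFields.BalabanUV.Beta.D1BFx.TorusCombKKT (CombRows)
open Summit.QuantumFields.BalabanUV.Beta.D1BFx.GramWeightColourLift (tgram₁)
open Summit.QuantumFields.BalabanUV.Beta.D1BFx.TorusCoframeJets (Djet Ljet Mjet₀ Mjet₁ Tjet₀ Tjet₁ Ajet₀ Ajet₁ transpose_Ljet)
open Summit.QuantumFields.BalabanUV.Beta.D1BFx.TorusWeightJetsCombFree (Chat Cjet₁ Lsq₁)
open Summit.QuantumFields.BalabanUV.Beta.D1BFx.TorusWeightJetsTwisted (twgt₁ tgram₁_Tjet)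
open Summit.QuantumFields.BalabanUV.Beta.D1BFx.TorusJetSandwichArrays (jetR jetC jetR_apply jetC_apply)
open Summit.QuantumFields.BalabanUV.Beta.D1BFx.TorusGhostWordArrays (perT lapU Lgh Lgh_translate)
open Summit.QuantumFields.BalabanUV.Beta.D1BFx.KGhostLeg (Cgh)
open Summit.QuantumFields.BalabanUV.Beta.D1BFx.TorusBondArrays (hat_arr_add hat_arr_sub hat_arr_smul Dhat_mul_perT_arr_mul_Dhat_transpose
  dB dB_pos decays_lapU_Cgh decays_Cgh_lapU shiftK_lapU_Cgh shiftK_Cgh_lapU)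
open Summit.QuantumFields.BalabanUV.Beta.D1BFx.TorusWeightWordArrays (wL wR wC Ljet_Cgh_Lhat Lhat_Cgh_Ljet Lhat_Cgh_Lsq_Cgh_Lhat biLoc_lapU_Cgh_Lgh
  shiftK_Rgt_mul Djet_Rhat_Dhat_transpose Dhat_Rhat_Djet_transpose biLoc_dSw_wL biLoc_dSw_wR biLoc_dSw_wC biLoc_jetR_jetC)
open Summit.QuantumFields.BalabanUV.Beta.D1BFx.KGhostLegJunction (Chat_eq_submatrix_periodiseF_Cgh)

/-! ## §1 The twisted bond kernel -/

section Kernel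

variable (n : ℕ) [NeZero n] (a : ℝ) (κ : Fin 4) (u : Fin 4 → ℤ)

/-- [our object] **THE BOND TABLE OF `2•twgt₁`**: `tBw₁ := 2•(dSw wL + jetR κ u Rgt − dSw wC + dSw wR − jetC κ u Rgt)` — FILE N2's `Bw₁` with the two
letters of the `M̂ₛᵀĈM̂₀`-term (`dSw wL`, `jetR`) re-signed.  A definition; asserts nothing. -/
def tBw₁ : MKer 4 (Fin 4) :=
  (2 : ℝ) • (dSw (wL n a κ u) + jetR κ u (Rgt n a) - dSw (wC n a κ u) + dSw (wR n a κ u) - jetC κ u (Rgt n a))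

end Kernel

/-! ## §2 Period covariance -/

section Covariance

variable {D : ℕ} {F : Type*}

/-- [folklore] `shiftK` is additive (definitional). -/
theorem shiftK_add' (v : Fin D → ℤ) (K L : MKer D F) : shiftK v (K + L) = shiftK v K + shiftK v L := rfl

/-- [folklore] `shiftK` is subtractive (definitional). -/
theorem shiftK_sub' (v : Fin D → ℤ) (K L : MKer D F) : shiftK v (K - L) = shiftK v K - shiftK v L := rfl

/-- [folklore] `shiftK` commutes with scalars (definitional). -/
theorem shiftK_smul' (v : Fin D → ℤ) (c : ℝ) (K : MKer D F) : shiftK v (c • K) = c • shiftK v K := rfl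

variable (κ : Fin 4) (u : Fin 4 → ℤ)

/-- [folklore] **FINE-TRANSLATION COVARIANCE OF THE ROW-PINNED WORD**: `jetR κ (u + v) Y = shiftK (−v) (jetR κ u (shiftK v Y))`. -/
theorem jetR_translate (v : Fin 4 → ℤ) (Y : MKer 4 Unit) : jetR κ (u + v) Y = shiftK (-v) (jetR κ u (shiftK v Y)) := by
  funext x z α β
  show jetR κ (u + v) Y x z α β = jetR κ u (shiftK v Y) (x + -v) (z + -v) α β
  rw [jetR_apply, jetR_apply]
  have e : (x = u + v ∧ α = κ) ↔ (x + -v = u ∧ α = κ) := by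
    constructor
    · rintro ⟨h, h'⟩; exact ⟨by rw [h]; abel, h'⟩
    · rintro ⟨h, h'⟩; exact ⟨by rw [← h]; abel, h'⟩
  simp only [shiftK, e]
  congr 1
  rw [show u + v + unitVec κ = u + unitVec κ + v by abel, show z + -v + unitVec β + v = z + unitVec β by abel,
    show z + -v + v = z by abel]

/-- [folklore] **FINE-TRANSLATION COVARIANCE OF THE COLUMN-PINNED WORD**: `jetC κ (u + v) Y = shiftK (−v) (jetC κ u (shiftK v Y))`. -/
theorem jetC_translate (v : Fin 4 → ℤ) (Y : MKer 4 Unit) : jetC κ (u + v) Y = shiftK (-v) (jetC κ u (shiftK v Y)) := by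
  funext x z α β
  show jetC κ (u + v) Y x z α β = jetC κ u (shiftK v Y) (x + -v) (z + -v) α β
  rw [jetC_apply, jetC_apply]
  have e : (z = u + v ∧ β = κ) ↔ (z + -v = u ∧ β = κ) := by
    constructor
    · rintro ⟨h, h'⟩; exact ⟨by rw [h]; abel, h'⟩
    · rintro ⟨h, h'⟩; exact ⟨by rw [← h]; abel, h'⟩
  simp only [shiftK, e]
  congr 1
  rw [show u + v + unitVec κ = u + unitVec κ + v by abel, show x + -v + unitVec α + v = x + unitVec α by abel,
    show x + -v + v = x by abel]

variable (m : ℕ) {a : ℝ} (p : ℕ)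

/-- [folklore] PERIOD COVARIANCE of `wL`: `wL (m+1) a κ (u + s·t) = shiftK (−s·t) (wL (m+1) a κ u)`, `s = (m+1)·p` (`ghCur` is covariant under every
translation, the leg `Cgh ∘ lapU` under the block translations). -/
theorem wL_translate (ha : 0 < a) (t : Fin 4 → ℤ) :
    wL (m + 1) a κ (u + ((((m + 1) * p : ℕ) : ℤ) • t)) = shiftK (-((((m + 1) * p : ℕ) : ℤ) • t)) (wL (m + 1) a κ u) := by
  have h := shiftK_Cgh_lapU (m + 1) a ha p (-t)
  rw [smul_neg] at h
  rw [wL, wL, ghCur_translate]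
  conv_rhs => rw [← comp_shiftK, h]

/-- [folklore] PERIOD COVARIANCE of `wR`. -/
theorem wR_translate (ha : 0 < a) (t : Fin 4 → ℤ) :
    wR (m + 1) a κ (u + ((((m + 1) * p : ℕ) : ℤ) • t)) = shiftK (-((((m + 1) * p : ℕ) : ℤ) • t)) (wR (m + 1) a κ u) := by
  have h := shiftK_lapU_Cgh (m + 1) a ha p (-t)
  rw [smul_neg] at h
  rw [wR, wR, ghCur_translate]
  conv_rhs => rw [← comp_shiftK, h]

/-- [folklore] PERIOD COVARIANCE of `wC`. -/
theorem wC_translate (ha : 0 < a) (t : Fin 4 → ℤ) :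
    wC (m + 1) a κ (u + ((((m + 1) * p : ℕ) : ℤ) • t)) = shiftK (-((((m + 1) * p : ℕ) : ℤ) • t)) (wC (m + 1) a κ u) := by
  have h₁ := shiftK_lapU_Cgh (m + 1) a ha p (-t)
  have h₂ := shiftK_Cgh_lapU (m + 1) a ha p (-t)
  rw [smul_neg] at h₁ h₂
  rw [wC, wC, Lgh_translate]
  conv_rhs => rw [← comp_shiftK, ← comp_shiftK, h₁, h₂]

/-- [folklore] **PERIOD COVARIANCE OF THE TWISTED BOND KERNEL**: `tBw₁ (m+1) a κ (u + s·t) = shiftK (−s·t) (tBw₁ (m+1) a κ u)`, `s = (m+1)·p` —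
the hypothesis `hScov` of `PeriodicArrayPackingPlain.periodiseF_toF_arr_dirsum_wsum` (the kernel is NOT covariant under finer translations:
`Cgh`, `Rgt` are block-periodic only). -/
theorem tBw₁_translate (ha : 0 < a) (t : Fin 4 → ℤ) :
    tBw₁ (m + 1) a κ (u + ((((m + 1) * p : ℕ) : ℤ) • t)) = shiftK (-((((m + 1) * p : ℕ) : ℤ) • t)) (tBw₁ (m + 1) a κ u) := by
  have hR := shiftK_Rgt_mul m p ha t
  rw [tBw₁, tBw₁, wL_translate κ u m p ha, wR_translate κ u m p ha, wC_translate κ u m p ha, jetR_translate, jetC_translate, hR,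
    dSw_shiftK, dSw_shiftK, dSw_shiftK, shiftK_smul', shiftK_sub', shiftK_add', shiftK_sub', shiftK_add']

/-- [folklore] … in the `imageShift` spelling of TA2 ∕ FILE 1 («PACK-PLAIN»'s `hScov`). -/
theorem tBw₁_imageShift (ha : 0 < a) (t : Fin 4 → ℤ) :
    tBw₁ (m + 1) a κ (imageShift ((m + 1) * p) u t) = shiftK (-((((m + 1) * p : ℕ) : ℤ) • t)) (tBw₁ (m + 1) a κ u) := by
  rw [imageShift_eq_add_smul]
  exact tBw₁_translate κ u m p ha t

end Covariance

/-! ## §3 Localisation (one rate `dB/8`, one constant for every bond) -/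

section Loc

variable (m : ℕ) {a : ℝ}

/-- [folklore] **LOCALISATION SOCKET OF `tBw₁`**: ONE constant and ONE rate `dB/8` for every bond (the same term bounds as FILE N2's `biLoc_Bw₁`). -/
theorem biLoc_tBw₁ (ha : 0 < a) : ∃ C : ℝ, 0 ≤ C ∧ ∀ (κ : Fin 4) (u : Fin 4 → ℤ), BiLoc (tBw₁ (m + 1) a κ u) u u C (dB (m + 1) a / 8) := by
  obtain ⟨C₁, h10, h₁⟩ := biLoc_dSw_wL m ha
  obtain ⟨C₂, h20, h₂⟩ := biLoc_jetR_jetC m ha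
  obtain ⟨C₃, h30, h₃⟩ := biLoc_dSw_wC m ha
  obtain ⟨C₄, h40, h₄⟩ := biLoc_dSw_wR m ha
  refine ⟨|(2 : ℝ)| * (C₁ + C₂ + C₃ + C₄ + C₂), by positivity, fun κ u => ?_⟩
  rw [tBw₁]
  exact StepJetData.biLoc_smul (biLoc_sub (biLoc_add (biLoc_sub (biLoc_add (h₁ κ u) (h₂ κ u).1) (h₃ κ u)) (h₄ κ u)) (h₂ κ u).2) 2

end Loc

/-! ## §4 The twisted first weight jet as one bond array -/

section Assembly

variable (m : ℕ) {a : ℝ} (p : ℕ) [NeZero p] {ρ : Type*} [Fintype ρ] [DecidableEq ρ] (κ : Fin 4) (u : Fin 4 → ℤ)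

/-- [folklore] **`2•twgt₁ = (arr tBw₁)^`**: twice the TWISTED first weight jet of 3a′ at the torus bond `(σu, κ)`, over any basis `N` of `ker Ŝ`,
is the bond-fibred periodisation of TA2's array of the fixed `ℤ⁴` kernel `tBw₁ (m+1) a κ u` (FILE N2's three term letters, the first re-signed). -/
theorem two_smul_twgt₁_eq_hat (ha : 0 < a) {N : Matrix (Site 4 ((m + 1) * p)) ρ ℝ}
    (hN : ∀ lam : Site 4 ((m + 1) * p) → ℝ, Shat m ((m + 1) * p) *ᵥ lam = 0 ↔ ∃ c : ρ → ℝ, lam = N *ᵥ c)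
    (hNinj : Function.Injective N.mulVec) :
    (2 : ℝ) • twgt₁ ((m + 1) * p) (siteOf 4 ((m + 1) * p) u, κ) N
      = Matrix.of (periodiseF ((m + 1) * p) (toF (arr ((m + 1) * p) (tBw₁ (m + 1) a κ u)))) := by
  have hd := dB_pos (m + 1) a ha
  have hd8 : 0 < dB (m + 1) a / 8 := by linarith
  obtain ⟨C₁, -, h₁⟩ := biLoc_dSw_wL m ha
  obtain ⟨C₂, -, h₂⟩ := biLoc_jetR_jetC m ha
  obtain ⟨C₃, -, h₃⟩ := biLoc_dSw_wC m ha
  obtain ⟨C₄, -, h₄⟩ := biLoc_dSw_wR m ha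
  obtain ⟨CL, -, hL⟩ := (show ∃ C : ℝ, 0 ≤ C ∧ ∀ (κ : Fin 4) (u : Fin 4 → ℤ), BiLoc (wL (m + 1) a κ u) u u C (dB (m + 1) a / 4) from by
    obtain ⟨C, hC⟩ := decays_Cgh_lapU (m + 1) a ha
    exact ⟨_, mul_nonneg (mul_nonneg (Nat.cast_nonneg _) (mul_nonneg (Real.exp_pos _).le (hC.nonneg ()))) (ExpKernelCalculus.Zl_pos (by linarith)).le,
      fun κ u => biLoc_comp_right (biLoc_ghCur κ u (dB (m + 1) a / 2)) hC (by linarith) (by linarith : dB (m + 1) a / 4 < dB (m + 1) a / 2)⟩)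
  obtain ⟨CR, -, hR⟩ := (show ∃ C : ℝ, 0 ≤ C ∧ ∀ (κ : Fin 4) (u : Fin 4 → ℤ), BiLoc (wR (m + 1) a κ u) u u C (dB (m + 1) a / 4) from by
    obtain ⟨C, hC⟩ := decays_lapU_Cgh (m + 1) a ha
    exact ⟨_, mul_nonneg (mul_nonneg (Nat.cast_nonneg _) (mul_nonneg (hC.nonneg ()) (Real.exp_pos _).le)) (ExpKernelCalculus.Zl_pos (by linarith)).le,
      fun κ u => biLoc_comp_decays hC (biLoc_ghCur κ u (dB (m + 1) a / 2)) (by linarith) (by linarith : dB (m + 1) a / 4 < dB (m + 1) a / 2)⟩)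
  obtain ⟨CC, -, hC'⟩ := (show ∃ C : ℝ, 0 ≤ C ∧ ∀ (κ : Fin 4) (u : Fin 4 → ℤ), BiLoc (wC (m + 1) a κ u) u u C (dB (m + 1) a / 8) from by
    obtain ⟨C₂', hC₂⟩ := decays_Cgh_lapU (m + 1) a ha
    obtain ⟨C₃', h3, hC₃⟩ := biLoc_lapU_Cgh_Lgh m ha
    have hC₂'' : Decays (comp (Cgh (m + 1) a) lapU) (|C₂'|) (dB (m + 1) a / 4) := decays_of_le hC₂ (by linarith)
    exact ⟨_, mul_nonneg (mul_nonneg (Nat.cast_nonneg _) (mul_nonneg h3 (abs_nonneg _))) (ExpKernelCalculus.Zl_pos (by linarith)).le,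
      fun κ u => biLoc_comp_right (hC₃ κ u) hC₂'' (by linarith) (by linarith : dB (m + 1) a / 8 < dB (m + 1) a / 4)⟩)
  have hCh : Chat ((m + 1) * p) N = perT ((m + 1) * p) (Cgh (m + 1) a) := Chat_eq_submatrix_periodiseF_Cgh m p ha hN hNinj
  -- the three terms of `twgt₁` (FILE N2's letters)
  have hTb : (Mjet₁ ((m + 1) * p) (siteOf 4 ((m + 1) * p) u, κ))ᵀ * Chat ((m + 1) * p) N * Mjet₀ ((m + 1) * p)
      = -Matrix.of (periodiseF ((m + 1) * p) (toF (arr ((m + 1) * p) (dSw (wL (m + 1) a κ u)))))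
          - Matrix.of (periodiseF ((m + 1) * p) (toF (arr ((m + 1) * p) (jetR κ u (Rgt (m + 1) a))))) := by
    have e1 : (Mjet₁ ((m + 1) * p) (siteOf 4 ((m + 1) * p) u, κ))ᵀ * Chat ((m + 1) * p) N * Mjet₀ ((m + 1) * p)
        = -(Dhat 4 ((m + 1) * p) * (Ljet ((m + 1) * p) (siteOf 4 ((m + 1) * p) u, κ) * (Chat ((m + 1) * p) N * Lhat ((m + 1) * p))) * (Dhat 4 ((m + 1) * p))ᵀ)
            - Djet ((m + 1) * p) (siteOf 4 ((m + 1) * p) u, κ) * (Lhat ((m + 1) * p) * Chat ((m + 1) * p) N * Lhat ((m + 1) * p)) * (Dhat 4 ((m + 1) * p))ᵀ := by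
      rw [Mjet₁, Mjet₀, Matrix.transpose_sub, Matrix.transpose_mul, Matrix.transpose_mul, Matrix.transpose_transpose,
        Matrix.transpose_transpose, transpose_Ljet, Lhat_transpose]
      simp only [Matrix.sub_mul, Matrix.neg_mul, Matrix.mul_neg, Matrix.mul_assoc]
    rw [e1, Djet_Rhat_Dhat_transpose m p κ u ha hN hNinj, hCh, Ljet_Cgh_Lhat m p κ u ha,
      Dhat_mul_perT_arr_mul_Dhat_transpose _ (hL κ u) (by linarith)]
  have hTc : (Mjet₀ ((m + 1) * p))ᵀ * Cjet₁ ((m + 1) * p) (siteOf 4 ((m + 1) * p) u, κ) N * Mjet₀ ((m + 1) * p)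
      = -Matrix.of (periodiseF ((m + 1) * p) (toF (arr ((m + 1) * p) (dSw (wC (m + 1) a κ u))))) := by
    have e1 : (Mjet₀ ((m + 1) * p))ᵀ * Cjet₁ ((m + 1) * p) (siteOf 4 ((m + 1) * p) u, κ) N * Mjet₀ ((m + 1) * p)
        = -(Dhat 4 ((m + 1) * p) * (Lhat ((m + 1) * p) * Chat ((m + 1) * p) N * (Ljet ((m + 1) * p) (siteOf 4 ((m + 1) * p) u, κ) * Lhat ((m + 1) * p) + Lhat ((m + 1) * p) * Ljet ((m + 1) * p) (siteOf 4 ((m + 1) * p) u, κ))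
            * (Chat ((m + 1) * p) N * Lhat ((m + 1) * p))) * (Dhat 4 ((m + 1) * p))ᵀ) := by
      rw [Cjet₁, Lsq₁, Mjet₀, Matrix.transpose_mul, Matrix.transpose_transpose, Lhat_transpose]
      simp only [Matrix.mul_neg, Matrix.neg_mul, Matrix.mul_assoc]
    rw [e1, hCh, Lhat_Cgh_Lsq_Cgh_Lhat m p κ u ha, Dhat_mul_perT_arr_mul_Dhat_transpose _ (hC' κ u) hd8]
  have hTa : (Mjet₀ ((m + 1) * p))ᵀ * Chat ((m + 1) * p) N * Mjet₁ ((m + 1) * p) (siteOf 4 ((m + 1) * p) u, κ)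
      = Matrix.of (periodiseF ((m + 1) * p) (toF (arr ((m + 1) * p) (dSw (wR (m + 1) a κ u)))))
          - Matrix.of (periodiseF ((m + 1) * p) (toF (arr ((m + 1) * p) (jetC κ u (Rgt (m + 1) a))))) := by
    have e1 : (Mjet₀ ((m + 1) * p))ᵀ * Chat ((m + 1) * p) N * Mjet₁ ((m + 1) * p) (siteOf 4 ((m + 1) * p) u, κ)
        = Dhat 4 ((m + 1) * p) * (Lhat ((m + 1) * p) * Chat ((m + 1) * p) N * Ljet ((m + 1) * p) (siteOf 4 ((m + 1) * p) u, κ)) * (Dhat 4 ((m + 1) * p))ᵀ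
            - Dhat 4 ((m + 1) * p) * (Lhat ((m + 1) * p) * Chat ((m + 1) * p) N * Lhat ((m + 1) * p)) * (Djet ((m + 1) * p) (siteOf 4 ((m + 1) * p) u, κ))ᵀ := by
      rw [Mjet₁, Mjet₀, Matrix.transpose_mul, Matrix.transpose_transpose, Lhat_transpose]
      simp only [Matrix.mul_sub, Matrix.mul_assoc]
    rw [e1, Dhat_Rhat_Djet_transpose m p κ u ha hN hNinj, hCh, Lhat_Cgh_Ljet m p κ u ha,
      Dhat_mul_perT_arr_mul_Dhat_transpose _ (hR κ u) (by linarith)]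
  -- assemble (the expression tree of `tBw₁`: `(((dSw wL + jetR) − dSw wC) + dSw wR) − jetC`)
  have hE1 : BiLoc (dSw (wL (m + 1) a κ u)) u u C₁ (dB (m + 1) a / 8) := h₁ κ u
  have hE2 := biLoc_add hE1 (h₂ κ u).1
  have hE3 := biLoc_sub hE2 (h₃ κ u)
  have hE4 := biLoc_add hE3 (h₄ κ u)
  rw [twgt₁, hTb, hTc, hTa, tBw₁, hat_arr_smul, hat_arr_sub _ hE4 hd8 (h₂ κ u).2 hd8, hat_arr_add _ hE3 hd8 (h₄ κ u) hd8,
    hat_arr_sub _ hE2 hd8 (h₃ κ u) hd8, hat_arr_add _ hE1 hd8 (h₂ κ u).1 hd8]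
  simp only [smul_add, smul_sub, smul_neg, neg_sub]
  abel

/-- [folklore] **THE TWISTED CO-FRAME WEIGHT JET OF ONE BOND IS AN ARRAY**: for any basis `N` of `ker Ŝ` and any re-indexing `e` of the bonds,
`tgram₁ (Tjet₀ s N e) (Tjet₁ s (σu,κ) N e) (Ajet₀ s N) (Ajet₁ s (σu,κ) N) = ((toF (arr s (tBw₁ (m+1) a κ u)))^).submatrix e e` (3a′ `tgram₁_Tjet` + §4). -/
theorem tgram₁_Tjet_eq_hat_submatrix (ha : 0 < a) {N : Matrix (Site 4 ((m + 1) * p)) ρ ℝ}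
    (hN : ∀ lam : Site 4 ((m + 1) * p) → ℝ, Shat m ((m + 1) * p) *ᵥ lam = 0 ↔ ∃ c : ρ → ℝ, lam = N *ᵥ c)
    (hNinj : Function.Injective N.mulVec) {ν : Type*} (e : ν → Site 4 ((m + 1) * p) × Fin 4) :
    tgram₁ (Tjet₀ ((m + 1) * p) N e) (Tjet₁ ((m + 1) * p) (siteOf 4 ((m + 1) * p) u, κ) N e) (Ajet₀ ((m + 1) * p) N)
        (Ajet₁ ((m + 1) * p) (siteOf 4 ((m + 1) * p) u, κ) N)
      = (Matrix.of (periodiseF ((m + 1) * p) (toF (arr ((m + 1) * p) (tBw₁ (m + 1) a κ u))))).submatrix e e := by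
  rw [tgram₁_Tjet, two_smul_twgt₁_eq_hat m p κ u ha hN hNinj]

variable {r : Fin 4 → ℕ}

/-- [folklore] **`2•twgt₁ = (arr tBw₁)^` AT THE ROAD's COMB BASIS `N̂`** (`r ∈ box 4 (m+1)`; `TorusGaugeBasisKernel.Nhat_range ∕ Nhat_injective`). -/
theorem two_smul_twgt₁_Nhat_eq_hat (ha : 0 < a) (hr : r ∈ box (3 + 1) (m + 1)) :
    (2 : ℝ) • twgt₁ ((m + 1) * p) (siteOf 4 ((m + 1) * p) u, κ) (Nhat r (m + 1) p)
      = Matrix.of (periodiseF ((m + 1) * p) (toF (arr ((m + 1) * p) (tBw₁ (m + 1) a κ u)))) :=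
  two_smul_twgt₁_eq_hat m p κ u ha (Nhat_range r m p hr) (Nhat_injective r (m + 1) p hr)

/-- [folklore] **THE TWISTED CO-FRAME WEIGHT JET OF ONE BOND AT `N̂` IS AN ARRAY** — the per-bond summand of PART 3b's `hJN` letter (before response packing). -/
theorem tgram₁_Tjet_Nhat_eq_hat_submatrix (ha : 0 < a) (hr : r ∈ box (3 + 1) (m + 1)) {ν : Type*} (e : ν → Site 4 ((m + 1) * p) × Fin 4) :
    tgram₁ (Tjet₀ ((m + 1) * p) (Nhat r (m + 1) p) e) (Tjet₁ ((m + 1) * p) (siteOf 4 ((m + 1) * p) u, κ) (Nhat r (m + 1) p) e)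
        (Ajet₀ ((m + 1) * p) (Nhat r (m + 1) p)) (Ajet₁ ((m + 1) * p) (siteOf 4 ((m + 1) * p) u, κ) (Nhat r (m + 1) p))
      = (Matrix.of (periodiseF ((m + 1) * p) (toF (arr ((m + 1) * p) (tBw₁ (m + 1) a κ u))))).submatrix e e :=
  tgram₁_Tjet_eq_hat_submatrix m p κ u ha (Nhat_range r m p hr) (Nhat_injective r (m + 1) p hr) e

end Assembly

end Summit.QuantumFields.BalabanUV.Beta.D1BFx.TorusWeightWordTwisted

end
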